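import Literature.NumberTheory.Automorphic.SatakeParameterTrivialBound
import HarnessLib

/-!
# Jacquet–Shalika's Thm. (5.3) for pairs from Lemma (5.2), and (5.1.3) almost everywhere

Trunk `AutomorphicAxiomatic` (G19), topic `NumberTheory/Automorphic`; namespace `Literature.Automorphic`.
Companion to `JacquetShalikaEulerProducts` and `SatakeParameterTrivialBound`.

`SatakeParameterTrivialBound` removes the local bound (5.1.3) (`norm_satakeParameter_le_sqrt`,
i.e. Cor. (2.5) of Jacquet–Shalika, *On Euler products and the classification of automorphic
representations I*, Amer. J. Math. **103** (1981)) from the hypotheses of the Landau step of the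
printed proof of loc. cit. Thm. (5.3) in the case `π' = 1`: `multipliable_partialStandardL`,
`absolutelyConvergent_partialStandardL`, `StandardLFunctionData.multipliable_L` now rest on
Lemma (5.2) (`JacquetShalika1981_continuation_partialPairL_conj`, the continuation of
`L_S(s, π × π̄)` to `re s > 1`) and the finiteness of ramification
(`eventually_cofinite_isUnramifiedAt`). This file does the same for the remaining consequences
recorded in `JacquetShalikaEulerProducts`, everything being **proved**:

* `JacquetShalika1981_multipliable_partialPairL_of_lemma52'` — **Thm. (5.3) for pairs**
  (the named fact `JacquetShalika1981_multipliable_partialPairL` of `PairLFunctionBaseChange`: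
  `∏_{v ∉ S} det(1 - q_v^{-s} A_v ⊗ A'_v)⁻¹` is multipliable on `re s > 1`) from Lemma (5.2) for
  `π` and for `π'` and the finiteness of ramification, *without* (5.1.3) (compare
  `JacquetShalika1981_multipliable_partialPairL_of_lemma52`, which assumes it at `GL_n` and at
  `GL_m`). Proof: enlarge both Satake families to a common finite large set `S₂`
  (`exists_finset_isSatakeFamilyOf_extend`); off `S₂`, (5.3.3) holds for both families
  (`summable_normSq_trace_finset_of_lemma52'`, Landau's lemma with the proved trivial bound),
  hence (5.1.3) for both (`norm_le_sqrt_of_summable_normSq_trace`), so the analytic core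
  `multipliable_inv_satakePairPolynomial` (Cauchy–Schwarz (5.3.5) and (2), loc. cit. p. 556)
  applies off `S ∪ S₂`; the finitely many factors at `v ∈ S₂ ∖ S`, whatever they are, are put
  back (`multipliable_compl_of_union_finite`).
* `norm_satakeParameter_le_sqrt_of_lemma52_of_not_mem` — **(5.1.3) at all but finitely many
  places from Lemma (5.2)**: for a cuspidal `Π` there is a finite set `E` of places such that
  every Satake family `α` of `Π` off any `S` satisfies `|a| ≤ q_v^{1/2}`, `a ∈ α v`, `v ∉ S ∪ E`
  (at the finitely many unramified places of the set `S₀` of Lemma (5.2) the lemma is silent;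
  there the bound is Cor. (2.5) of the source).
* `eventually_cofinite_isUnramifiedAt_of_exists_hasSatakeParameterAt_cofinite` — the named fact
  `eventually_cofinite_isUnramifiedAt` of `GLnCuspidalSpectrum` from the root named fact
  `exists_hasSatakeParameterAt_cofinite` (Flath (1979), Thm. 3: one level `𝔫 ≠ 0` and Satake
  parameters with respect to `K(𝔫)` at almost all `v`; a non-zero ideal has finitely many prime
  divisors — the interim proof recorded in `GLnCuspidalSpectrum`, threaded), so that
  `multipliable_partialStandardL_of_lemma52_of_cofinite` rests the named fact
  `multipliable_partialStandardL` of `AutomorphicLFunction` on the two *root* named facts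
  Lemma (5.2) and `exists_hasSatakeParameterAt_cofinite` only.

Resulting dependency graph of the Jacquet–Shalika facts of the topic:
`multipliable_L ⇐ Lemma (5.2)` (`SatakeParameterTrivialBound`);
`multipliable_partialStandardL`, `absolutelyConvergent_partialStandardL`,
`L_eq_partialStandardL_mul`, `JacquetShalika1981_multipliable_partialPairL`, (5.1.3) almost
everywhere `⇐ Lemma (5.2) + eventually_cofinite_isUnramifiedAt ⇐ Lemma (5.2) +
exists_hasSatakeParameterAt_cofinite`.

## References

* H. Jacquet, J. A. Shalika, *On Euler products and the classification of automorphic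
  representations I*, Amer. J. Math. 103 (1981), 499–558 [JacquetShalikaAJM1981]: (5.1),
  (5.1.3) and Lemma (5.2) p. 554; Thm. (5.3) p. 555, proof pp. 555–557 ((1)–(5) p. 556);
  Remark (5.4) p. 557; Cor. (2.5) p. 515.
* D. Flath, *Decomposition of representations into tensor products*, Thm. 3; A. Borel,
  H. Jacquet, *Automorphic forms and automorphic representations*, §4.6 — Proc. Sympos. Pure
  Math. 33, Part 1 (Corvallis 1979) [BorelJacquetCorvallis1979].

## Design notes

No definition, no named fact. The index-set combinators `multipliable_compl_of_union_finite`
(any commutative topological monoid) and `summable_prod_compl_union_of_summable` complement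
`summable_compl_of_subset_union_finite` (`SatakeParameterTrivialBound`) and
`summable_prod_compl_of_subset_union_finite` (`JacquetShalikaEulerProducts`), which are
real-valued and, for the latter, need local information at the added places.
-/

noncomputable section

open scoped MatrixGroups ComplexConjugate
open NumberField IsDedekindDomain MeasureTheory Complex Filter Topology

namespace Literature.NumberTheory.Automorphic

/-! ### Index sets: restricting to, and extending by, finitely many places -/

section IndexSets

variable {X M : Type*}

/-- **A product over `v ∉ S` is multipliable as soon as it is multipliable over `v ∉ S ∪ T` for
some finite `T`** (the finitely many factors at `v ∈ T ∖ S`, whatever they are, form a finite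
product; Mathlib `Multipliable.mul_compl`). [folklore] -/
theorem multipliable_compl_of_union_finite [CommMonoid M] [TopologicalSpace M] [ContinuousMul M]
    (f : X → M) {S T : Set X} (hT : T.Finite)
    (h : Multipliable fun v : {v : X // v ∉ S ∪ T} => f v.1) :
    Multipliable fun v : {v : X // v ∉ S} => f v.1 := by
  have hsfin : ({v | v.1 ∈ T} : Set {v : X // v ∉ S}).Finite :=
    hT.preimage Subtype.val_injective.injOn
  refine Multipliable.mul_compl (s := {v | v.1 ∈ T}) (hsfin.multipliable _) ?_
  let e : {v : X // v ∉ S ∪ T} ≃ (({v | v.1 ∈ T} : Set {v : X // v ∉ S})ᶜ : Set _) :=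
    { toFun := fun v => ⟨⟨v.1, fun h' => v.2 (Or.inl h')⟩, fun h' => v.2 (Or.inr h')⟩
      invFun := fun v => ⟨v.1.1, fun h' => h'.elim v.1.2 v.2⟩
      left_inv := fun _ => rfl
      right_inv := fun _ => rfl }
  have h' : Multipliable
      ((fun v : (({v | v.1 ∈ T} : Set {v : X // v ∉ S})ᶜ : Set _) => f v.1.1) ∘ e) := h
  exact e.multipliable_iff.mp h'

/-- **Restriction of a convergent double series of reals to fewer places**: if
`∑_{k, v ∉ T} g(k, v)` converges (in `ℝ`), so does the sub-family `∑_{k, v ∉ S ∪ T} g(k, v)`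
(Mathlib `Summable.comp_injective`). [folklore] -/
theorem summable_prod_compl_union_of_summable (g : ℕ × X → ℝ) {S T : Set X}
    (h : Summable fun i : ℕ × {v : X // v ∉ T} => g (i.1, i.2.1)) :
    Summable fun i : ℕ × {v : X // v ∉ S ∪ T} => g (i.1, i.2.1) := by
  let ι : ℕ × {v : X // v ∉ S ∪ T} → ℕ × {v : X // v ∉ T} :=
    fun i => (i.1, ⟨i.2.1, fun h' => i.2.2 (Or.inr h')⟩)
  have hι : Function.Injective ι := by
    rintro ⟨k, v, hv⟩ ⟨k', v', hv'⟩ h'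
    simp only [ι, Prod.mk.injEq, Subtype.mk.injEq] at h'
    obtain ⟨rfl, rfl⟩ := h'
    rfl
  exact h.comp_injective hι

end IndexSets

/-! ### Finiteness of ramification; enlarging a Satake family; (5.1.3) almost everywhere -/

section Cuspidal

variable {n : ℕ} {K : Type} [Field K] [NumberField K]
  {μ : Measure (AdelicGroupData.gl n K).automorphicQuotient}
  [(AdelicGroupData.gl n K).IsAutomorphicMeasure μ]

/-- `eventually_cofinite_isUnramifiedAt` (a cuspidal `Π` is unramified at all but finitely many
places) from the root named fact `exists_hasSatakeParameterAt_cofinite` of `GLnCuspidalSpectrum`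
(Flath (1979), Thm. 3 / Borel–Jacquet (1979), §4.6: one level `𝔫 ≠ 0` and Satake parameters with
respect to `K(𝔫)` at almost all `v`): a non-zero ideal of `𝓞 K` has finitely many prime divisors
(Mathlib `Ideal.finite_factors`), and at `v ∤ 𝔫` the level `K(𝔫)` witnesses `IsUnramifiedAt`
(the interim proof recorded in `GLnCuspidalSpectrum`, threaded). [folklore] -/
theorem eventually_cofinite_isUnramifiedAt_of_exists_hasSatakeParameterAt_cofinite
    (h : exists_hasSatakeParameterAt_cofinite (μ := μ)) :
    eventually_cofinite_isUnramifiedAt (μ := μ) := by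
  intro P
  obtain ⟨𝔫, h𝔫, h𝔫P⟩ := h P
  have hfin : ∀ᶠ v : HeightOneSpectrum (𝓞 K) in Filter.cofinite, ¬ v.asIdeal ∣ 𝔫 :=
    (Ideal.finite_factors h𝔫).compl_mem_cofinite
  filter_upwards [h𝔫P, hfin] with v hv hv'
  obtain ⟨ϖ, α, hϖ⟩ := hv
  exact ⟨𝔫, h𝔫, hv', ϖ, α, hϖ⟩

/-- **`multipliable_partialStandardL` from the two root named facts** — Lemma (5.2) of
Jacquet–Shalika (`JacquetShalika1981_continuation_partialPairL_conj`) and Flath's theorem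
(`exists_hasSatakeParameterAt_cofinite`); everything in between is proved
(`multipliable_partialStandardL_of_lemma52'` of `SatakeParameterTrivialBound` and
`eventually_cofinite_isUnramifiedAt_of_exists_hasSatakeParameterAt_cofinite`).
[cite: JacquetShalikaAJM1981, Thm. (5.3), Lemma (5.2), Remark (5.4)] -/
theorem multipliable_partialStandardL_of_lemma52_of_cofinite
    (h₅₂ : JacquetShalika1981_continuation_partialPairL_conj (μ := μ))
    (hcof : exists_hasSatakeParameterAt_cofinite (μ := μ)) :
    multipliable_partialStandardL (μ := μ) :=
  multipliable_partialStandardL_of_lemma52' h₅₂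
    (eventually_cofinite_isUnramifiedAt_of_exists_hasSatakeParameterAt_cofinite hcof)

/-- **Enlarging a Satake family to a finite large exceptional set.** Given a Satake family `β` of
`Π` off the finite set `R` of its ramified places (`exists_isSatakeFamilyOf`; Flath (1979) /
Borel–Jacquet (1979), §4.6, plus choice), a finite `S₀`, and a Satake family `α` of `Π` off an
arbitrary `S`, the family "`α` off `S`, `β` on `S`" is a Satake family of `Π` off the finite set
`S' = R ∪ S₀ ⊇ S₀`, agrees with `α` off `S`, and `S' ∖ S₀` consists of ramified places. [folklore] -/
theorem exists_finset_isSatakeFamilyOf_extend (hex : exists_isSatakeFamilyOf (μ := μ))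
    (P : CuspidalAutomorphicRepGL n K μ) (S₀ : Finset (HeightOneSpectrum (𝓞 K)))
    {S : Set (HeightOneSpectrum (𝓞 K))} {α : SatakeFamily K} (hα : IsSatakeFamilyOf P S α) :
    ∃ (S' : Finset (HeightOneSpectrum (𝓞 K))) (α' : SatakeFamily K), S₀ ⊆ S' ∧
      (∀ v ∈ S', v ∉ S₀ → ¬ IsUnramifiedAt P.1 v) ∧ IsSatakeFamilyOf P ↑S' α' ∧
      ∀ v ∉ S, α' v = α v := by
  classical
  obtain ⟨R, β, hR, hβ⟩ := hex P
  refine ⟨R ∪ S₀, fun v => if v ∈ S then β v else α v, Finset.subset_union_right, ?_, ?_, ?_⟩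
  · intro v hv hv₀
    rcases Finset.mem_union.mp hv with h | h
    · exact hR v h
    · exact (hv₀ h).elim
  · intro v hv
    have hvR : v ∉ (↑R : Set (HeightOneSpectrum (𝓞 K))) := fun h =>
      hv (by rw [Finset.coe_union]; exact Or.inl h)
    by_cases hvS : v ∈ S
    · simp only [if_pos hvS]
      exact hβ v hvR
    · simp only [if_neg hvS]
      exact hα v hvS
  · intro v hv
    simp only [if_neg hv]

/-- **(5.1.3) at all but finitely many places from Lemma (5.2)** (and the finiteness of
ramification): for a cuspidal `Π` there is a finite set `E` of finite places (the ramified places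
together with the set `S₀` of Lemma (5.2)) such that for *every* Satake family `α` of `Π` off any
`S`, `|a| ≤ q_v^{1/2}` for all `a ∈ α v`, `v ∉ S`, `v ∉ E` (enlarge `α` to a family off `E` and
apply `norm_le_sqrt_finset_of_lemma52`'s mechanism: `summable_normSq_trace_finset_of_lemma52'`
and `norm_le_sqrt_of_summable_normSq_trace`). At the finitely many unramified places of `S₀`,
Lemma (5.2) is silent; there the bound is Cor. (2.5) of the source, the tree's named fact
`norm_satakeParameter_le_sqrt`. [cite: JacquetShalikaAJM1981, (5.1.3), Lemma (5.2)] -/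
theorem norm_satakeParameter_le_sqrt_of_lemma52_of_not_mem
    (h₅₂ : JacquetShalika1981_continuation_partialPairL_conj (μ := μ))
    (hfl : eventually_cofinite_isUnramifiedAt (μ := μ)) (P : CuspidalAutomorphicRepGL n K μ) :
    ∃ E : Finset (HeightOneSpectrum (𝓞 K)), ∀ ⦃S : Set (HeightOneSpectrum (𝓞 K))⦄
      ⦃α : SatakeFamily K⦄, IsSatakeFamilyOf P S α → ∀ ⦃v : HeightOneSpectrum (𝓞 K)⦄,
        v ∉ S → v ∉ E → ∀ ⦃a : ℂ⦄, a ∈ α v → ‖a‖ ≤ Real.sqrt v.residueCard := by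
  classical
  obtain ⟨S₀, hS₀⟩ := summable_normSq_trace_finset_of_lemma52' h₅₂ P
  obtain ⟨R, β, hR, hβ⟩ := exists_isSatakeFamilyOf_of_eventually_cofinite hfl P
  refine ⟨R ∪ S₀, fun S α hα v hvS hvE a ha => ?_⟩
  -- the family `α` off `S`, `β` on `S`, off `R ∪ S₀`
  let α' : SatakeFamily K := fun w => if w ∈ S then β w else α w
  have hα' : IsSatakeFamilyOf P ↑(R ∪ S₀) α' := by
    intro w hw
    have hwR : w ∉ (↑R : Set (HeightOneSpectrum (𝓞 K))) := fun h =>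
      hw (by rw [Finset.coe_union]; exact Or.inl h)
    by_cases hwS : w ∈ S
    · simp only [α', if_pos hwS]
      exact hβ w hwR
    · simp only [α', if_neg hwS]
      exact hα w hwS
  have hsum := hS₀ Finset.subset_union_right hα'
  have hvE' : v ∉ (↑(R ∪ S₀) : Set (HeightOneSpectrum (𝓞 K))) := fun h => hvE (Finset.mem_coe.mp h)
  have ha' : a ∈ α' v := by
    simp only [α', if_neg hvS]
    exact ha
  exact norm_le_sqrt_of_summable_normSq_trace (fun σ hσ => hsum hσ) hvE' ha'

end Cuspidal

/-! ### Theorem (5.3) for pairs from Lemma (5.2) for `π` and for `π'` -/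

section Pairs

variable {n m : ℕ} {K : Type} [Field K] [NumberField K]
  {μ : Measure (AdelicGroupData.gl n K).automorphicQuotient}
  [(AdelicGroupData.gl n K).IsAutomorphicMeasure μ]
  {μ' : Measure (AdelicGroupData.gl m K).automorphicQuotient}
  [(AdelicGroupData.gl m K).IsAutomorphicMeasure μ']

/-- **Jacquet–Shalika's Thm. (5.3) for pairs from Lemma (5.2)** (for `π` and for `π'`) and the
finiteness of ramification, *without* (5.1.3): the Euler product
`∏_{v ∉ S} det(1 - q_v^{-s} A_v ⊗ A'_v)⁻¹` of two cuspidal representations is multipliable on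
`re s > 1` (`JacquetShalika1981_multipliable_partialPairL` of `PairLFunctionBaseChange`). Enlarge
both families to a common finite large `S₂` (`exists_finset_isSatakeFamilyOf_extend`, twice); off
`S₂`, (5.3.3) holds for both (`summable_normSq_trace_finset_of_lemma52'`: Lemma (5.2) and the
proved trivial bound), hence (5.1.3) for both (`norm_le_sqrt_of_summable_normSq_trace`), so the
analytic core `multipliable_inv_satakePairPolynomial` (Cauchy–Schwarz (5.3.5) and (2), p. 556)
applies off `S ∪ S₂`; the finitely many factors at `v ∈ S₂ ∖ S` are put back
(`multipliable_compl_of_union_finite`). Compare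
`JacquetShalika1981_multipliable_partialPairL_of_lemma52`, which also assumes (5.1.3)
(`norm_satakeParameter_le_sqrt`) at `GL_n` and at `GL_m`.
[cite: JacquetShalikaAJM1981, Thm. (5.3), Lemma (5.2)] -/
theorem JacquetShalika1981_multipliable_partialPairL_of_lemma52'
    (h₅₂ : JacquetShalika1981_continuation_partialPairL_conj (μ := μ))
    (hfl : eventually_cofinite_isUnramifiedAt (μ := μ))
    (h₅₂' : JacquetShalika1981_continuation_partialPairL_conj (μ := μ'))
    (hfl' : eventually_cofinite_isUnramifiedAt (μ := μ')) :
    JacquetShalika1981_multipliable_partialPairL (n := n) (m := m) (K := K) (μ := μ) (μ' := μ') := by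
  classical
  intro P P' S α β hα hβ s hs
  obtain ⟨S₀, hS₀⟩ := summable_normSq_trace_finset_of_lemma52' h₅₂ P
  obtain ⟨S₀', hS₀'⟩ := summable_normSq_trace_finset_of_lemma52' h₅₂' P'
  obtain ⟨S₁, α₁, hS₁, -, hα₁, hαα₁⟩ := exists_finset_isSatakeFamilyOf_extend
    (exists_isSatakeFamilyOf_of_eventually_cofinite hfl) P (S₀ ∪ S₀') hα
  obtain ⟨S₂, β₂, hS₂, -, hβ₂, hββ₂⟩ := exists_finset_isSatakeFamilyOf_extend
    (exists_isSatakeFamilyOf_of_eventually_cofinite hfl') P' S₁ hβ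
  have hα₂ : IsSatakeFamilyOf P ↑S₂ α₁ := hα₁.mono (Finset.coe_subset.mpr hS₂)
  have hA := hS₀ ((Finset.subset_union_left.trans hS₁).trans hS₂) hα₂
  have hB := hS₀' ((Finset.subset_union_right.trans hS₁).trans hS₂) hβ₂
  -- off `S ∪ S₂`
  have hbα : ∀ v ∉ S ∪ ↑S₂, ∀ a ∈ α₁ v, ‖a‖ ≤ Real.sqrt v.residueCard := fun v hv a ha =>
    norm_le_sqrt_of_summable_normSq_trace (fun σ hσ => hA hσ) (fun h => hv (Or.inr h)) ha
  have hbβ : ∀ v ∉ S ∪ ↑S₂, ∀ b ∈ β₂ v, ‖b‖ ≤ Real.sqrt v.residueCard := fun v hv b hb =>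
    norm_le_sqrt_of_summable_normSq_trace (fun σ hσ => hB hσ) (fun h => hv (Or.inr h)) hb
  have hA' : Summable fun kv : ℕ × {v : HeightOneSpectrum (𝓞 K) // v ∉ S ∪ ↑S₂} =>
      ‖((α₁ kv.2.1).map (· ^ (kv.1 + 1))).sum‖ ^ 2 /
        ((kv.1 + 1 : ℝ) * (kv.2.1.residueCard : ℝ) ^ ((kv.1 + 1 : ℝ) * s.re)) :=
    summable_prod_compl_union_of_summable
      (fun kv : ℕ × HeightOneSpectrum (𝓞 K) => ‖((α₁ kv.2).map (· ^ (kv.1 + 1))).sum‖ ^ 2 /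
        ((kv.1 + 1 : ℝ) * (kv.2.residueCard : ℝ) ^ ((kv.1 + 1 : ℝ) * s.re))) (hA hs)
  have hB' : Summable fun kv : ℕ × {v : HeightOneSpectrum (𝓞 K) // v ∉ S ∪ ↑S₂} =>
      ‖((β₂ kv.2.1).map (· ^ (kv.1 + 1))).sum‖ ^ 2 /
        ((kv.1 + 1 : ℝ) * (kv.2.1.residueCard : ℝ) ^ ((kv.1 + 1 : ℝ) * s.re)) :=
    summable_prod_compl_union_of_summable
      (fun kv : ℕ × HeightOneSpectrum (𝓞 K) => ‖((β₂ kv.2).map (· ^ (kv.1 + 1))).sum‖ ^ 2 /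
        ((kv.1 + 1 : ℝ) * (kv.2.residueCard : ℝ) ^ ((kv.1 + 1 : ℝ) * s.re))) (hB hs)
  have hmul := multipliable_inv_satakePairPolynomial hbα hbβ hs hA' hB'
  -- back to `S`
  refine multipliable_compl_of_union_finite
    (fun v : HeightOneSpectrum (𝓞 K) =>
      ((satakePairPolynomial (α v) (β v)).eval ((v.residueCard : ℂ) ^ (-s)))⁻¹) S₂.finite_toSet ?_
  refine hmul.congr fun v => ?_
  have hv : v.1 ∉ S := fun h => v.2 (Or.inl h)
  simp only [hαα₁ v.1 hv, hββ₂ v.1 hv]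

/-- The same from the two root named facts, Lemma (5.2) and Flath's theorem
`exists_hasSatakeParameterAt_cofinite` (at `GL_n` and at `GL_m`).
[cite: JacquetShalikaAJM1981, Thm. (5.3), Lemma (5.2)] -/
theorem JacquetShalika1981_multipliable_partialPairL_of_lemma52_of_cofinite
    (h₅₂ : JacquetShalika1981_continuation_partialPairL_conj (μ := μ))
    (hcof : exists_hasSatakeParameterAt_cofinite (μ := μ))
    (h₅₂' : JacquetShalika1981_continuation_partialPairL_conj (μ := μ'))
    (hcof' : exists_hasSatakeParameterAt_cofinite (μ := μ')) :
    JacquetShalika1981_multipliable_partialPairL (n := n) (m := m) (K := K) (μ := μ) (μ' := μ') :=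
  JacquetShalika1981_multipliable_partialPairL_of_lemma52' h₅₂
    (eventually_cofinite_isUnramifiedAt_of_exists_hasSatakeParameterAt_cofinite hcof) h₅₂'
    (eventually_cofinite_isUnramifiedAt_of_exists_hasSatakeParameterAt_cofinite hcof')

end Pairs

end Literature.NumberTheory.Automorphic
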